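import Summits.QuantumFields.BalabanUV.Beta.FP.CoarseJetUnit
import Summits.QuantumFields.BalabanUV.Beta.FP.TorusCompositeSliceOneShot
import Summits.QuantumFields.BalabanUV.Beta.FP.NestedFPSplit

/-!
# `BalabanUV.Beta.FP.CoarseFPExponential` — road «FP» for binder row D1, ROUTE T (Q-FP-20-1 of the OWNER d1-p3 g20, journal [D1P3-G20-LANDED-2] ∕
# [D1P3-G20-CLOSING]): **THE COARSE CHART's FADDEEV–POPOV 2-JET IS AUTOMATIC WHEN THE COARSE JETS OBEY THE SQUARE LAW ON THE TOP COMB** — the `uTop`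
# input of `FP/NestedFPSplit` WITHOUT deadness: #19's displayed `hDb₁ hDb₂` («the coarse jets VANISH on the top comb») is the weight-zero case of ONE
# clause «on the top-comb bonds the coarse jets `D̄₁ D̄₂` are tip-type with `σ·D̄₂ = D̄₁²`», which ALSO holds when the jets are EXPONENTIAL along any
# coarse weight (the shape of leaf-02's depth-1 `D̄₁^{(h)} = of (−c·(Q₁₀ h)_a·[tip a = t])`); the door's `uT` then comes from the SPLIT with BOTH blocks
# automatic (`secondVar_nestedFP_eq_zero_of_blocks`)

WHAT.  §1 `secondVar_smul` — a common non-zero scalar drops out of a 2-jet (`CoarseJetUnit.secondVar_mul_left` at `C := σ • 1`).  §2 **`torus_uTop_exp`**: at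
the coarse slice of record `hτ₂ : τ₂ = combF Lc M′ r′`, for `D̄ := σ • tgrad M′↾(fields × Res (toSite r′))` (#19's `hDbar` shape, `σ = σ_{n+1} =
∏ stepScale·#B`, or `stepScale·#B` at depth 1) and coarse jets in the exponential closed forms `D̄₁ = σ • of (−(c̄·w̄ a)·[tip a = t])`, `D̄₂ = σ • of
((c̄·w̄ a)²·[tip a = t])` along ANY coarse weight `w̄` and constant `c̄`: `secondVar (τ₂ * D̄) (τ₂ * D̄₁) (τ₂ * D̄₂) = 0` — leaf-06 g19's
`TorusOneShotFPExponential.secondVar_combRowsT_expJets_eq_zero` on the torus `M′`, after the scalar and the field-slot reading are stripped.  §3 THE COMB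
READS NOTHING ELSE: `combF_mul_congr_of_eqOn_comb` (`τ₂ * D = τ₂ * E` as soon as `D` and `E` agree on the top-comb bonds — leaf-06 g18's
`torus_coarse_of_vanish_on_coarseComb` applied to `D − E`), hence **`torus_uTop_of_sq_on_comb`**: for ARBITRARY `D̄₁ D̄₂` that are, ON THE TOP-COMB BONDS
ONLY, tip-type with weights `u v` obeying `σ·v a = (u a)²` — `secondVar (τ₂ * D̄) (τ₂ * D̄₁) (τ₂ * D̄₂) = 0`; corollaries **`torus_uTop_of_exp_on_comb`**
(exponential on the comb) and **`torus_uTop_of_dead`** (#19's `hDb₁ hDb₂` VERBATIM ⇒ `uTop`: the case `u = v = 0`); `of_mul_mul_tgrad_eq_smul` bridges the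
depth-1 calls' `hDbar : D̄ = of (stepScale · (#B · tgrad …))` to the `σ • tgrad↾` shape used here (`σ := stepScale · #B`).  §4 the door's nested Faddeev–Popov
letter with BOTH blocks automatic: **`torus_uT_of_sq_on_comb`** = `NestedFPSplit.secondVar_nestedFP_eq_zero_of_blocks` with `hup :=
TorusCompositeSlice.det_combF_mul_smul_tgrad_res_ne_zero`, `uTop := §3` — GENERIC in the fine data (`τ₁ Q₁ₖ Wₖ` over any fine index and lower
parameter types, `c0 c1 c2 hlow uLow` displayed), so it serves the depth-1 call (`uLow := NestedFPSplit.torus_uLow_exp`) and the composite call #19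
(`uLow := TorusCompositeSliceOneShot.torus_uLow_oneShot_tower`) alike; `torus_uT_of_dead` is its weight-zero case (= #19's l.324–332 packaged).
[folklore]; no `def`, no `def … : Prop`, nothing cited, 0 sorry.  Nothing of the dictionary ∕ Bałaban's asserted; WHETHER leaf-02's (COV-m) order-2 row
delivers a `D̄₂` obeying the square law on the comb is NOT claimed here (leaf-02's ∕ an2's (J-a) word).

HONEST DEPENDENCY (page 1, mandatory): continuum YM on T⁴ ⇐ BetaPertH ∧ nine spine estimates (0/9 proved); BetaPertH ⇐ (D1) ∧ (D4) ∧ CAP+tail;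
G-an2-4 gates asym, D1 and NE2/3/4.  HONEST FRAMING (cell contract, verbatim): «discharging `BetaPertH` makes Bałaban's UV stability UNCONDITIONAL —
a real constructive-QFT result; it is NOT the continuum limit and NOT the Clay problem.»  ABSOLUTE RULE (cell charter, verbatim): «No internally-minted
statement may enter as a cited fact. Every hypothesis is either kernel-proved in this package or a verbatim quotation of a PUBLISHED theorem with page
reference. The manuscript(s) under audit are NOT citable for their own disputed steps — they are the thing under adjudication; programme-internal
(2001/route/tribunal) claims are never citable.»  0 estimates; 0∕4 row-D1 binders; NOT (T-ID), NOT SDF, NOT D1, NOT BetaPertH, NOT continuum, NOT Clay.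
D1 formalisation swarm LEAF PROVER 06 (b2b-balaban-beta-d1-formalise-leaf-06 gen 22; §1–§2 staged by gen 21), 2026-08-22.  No existing file touched.
-/

noncomputable section

namespace Summit.QuantumFields.BalabanUV.Beta.FP.CoarseFPExponential

open Matrix
open Literature.MathematicalPhysics.QuantumFieldTheory.Balaban1983to89
open Literature.MathematicalPhysics.QuantumFieldTheory.Balaban1983to89.Beta
open B6Lemma24Torus (pbox)
open AffineAveraging (Site box toSite unitVec)
open OneStepResolventKernel (Fib)
open Summit.QuantumFields.BalabanUV.Beta.AxialDressingRooted (IsCombBondAt)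
open Summit.QuantumFields.BalabanUV.Beta.D1BFx.LogDetSecondVariation (secondVar)
open Summit.QuantumFields.BalabanUV.Beta.FP.KernelPeriodisationFib (Idx)
open Summit.QuantumFields.BalabanUV.Beta.FP.TorusGaugeCovariance (tgrad tdelta)
open Summit.QuantumFields.BalabanUV.Beta.FP.TorusCombRows (Res combRowsT)
open Summit.QuantumFields.BalabanUV.Beta.FP.TorusOneShotFPExponential (secondVar_combRowsT_expJets_eq_zero)
open Summit.QuantumFields.BalabanUV.Beta.FP.NestedStepLawTorusInstance (submatrix_field_mul submatrix_id_mul)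
open Summit.QuantumFields.BalabanUV.Beta.FP.CoarseJetUnit (secondVar_mul_left)
open Summit.QuantumFields.BalabanUV.Beta.FP.TorusCompositeObjects (combF)
open Summit.QuantumFields.BalabanUV.Beta.FP.NestedStepLawTransportedDeadRows (torus_coarse_of_vanish_on_coarseComb)
open Summit.QuantumFields.BalabanUV.Beta.FP.TorusCompositeSlice (det_combF_mul_smul_tgrad_res_ne_zero)
open Summit.QuantumFields.BalabanUV.Beta.FP.NestedFPSplit (secondVar_nestedFP_eq_zero_of_blocks)
open Summit.QuantumFields.BalabanUV.Beta.GAN24.FineReadoutCauchyFrame (toSite_mem_range)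

variable {d : ℕ}

/-! ## §1 A common non-zero scalar drops out of a 2-jet -/

section Scalar

variable {ι : Type*} [Fintype ι] [DecidableEq ι]

/-- [folklore] `secondVar (σ•A₀) (σ•A₁) (σ•A₂) = secondVar A₀ A₁ A₂` for `σ ≠ 0` (`log|det (σ•A)| = log|det A| + const`). -/
theorem secondVar_smul {σ : ℝ} (hσ : σ ≠ 0) (A₀ A₁ A₂ : Matrix ι ι ℝ) :
    secondVar (σ • A₀) (σ • A₁) (σ • A₂) = secondVar A₀ A₁ A₂ := by
  have hC : IsUnit (σ • (1 : Matrix ι ι ℝ)).det := by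
    rw [Matrix.det_smul, Matrix.det_one, mul_one]
    exact isUnit_iff_ne_zero.2 (pow_ne_zero _ hσ)
  rw [← smul_one_mul σ A₀, ← smul_one_mul σ A₁, ← smul_one_mul σ A₂]
  exact secondVar_mul_left _ _ _ _ hC

end Scalar

/-! ## §2 The coarse chart's Faddeev–Popov 2-jet for exponential coarse jets -/

section Torus

variable (M' : Fin (d + 1) → ℕ) {Lc : ℕ} [NeZero Lc] {r' : Fin (d + 1) → ℕ}

/-- [folklore] **`uTop` IS AUTOMATIC FOR EXPONENTIAL COARSE JETS**: at the coarse slice `τ₂ = combF Lc M′ r′` of record, with `D̄ := σ • tgrad M′↾(fields × Res)`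
and the coarse jets in the exponential closed forms `D̄₁ = σ • of (−(c̄·w̄ a)·[tip a = t])`, `D̄₂ = σ • of ((c̄·w̄ a)²·[tip a = t])` along ANY coarse weight `w̄`:
`secondVar (τ₂ * D̄) (τ₂ * D̄₁) (τ₂ * D̄₂) = 0` — NO deadness of `w̄` on the coarse comb. -/
theorem torus_uTop_exp (hr' : r' ∈ box (d + 1) Lc) (hM' : ∀ i, Lc ∣ M' i) {τ₂ : Matrix (Res (toSite r') Lc M') (↥(pbox M') × Fin (d + 1)) ℝ}
    (hτ₂ : τ₂ = combF Lc M' r') {σ : ℝ} (hσ : σ ≠ 0) (cbar : ℝ) (wbar : ↥(pbox M') × Fin (d + 1) → ℝ)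
    {Dbar Db₁ Db₂ : Matrix (↥(pbox M') × Fin (d + 1)) (Res (toSite r') Lc M') ℝ}
    (hDbar : Dbar = σ • (tgrad M').submatrix (fun a : ↥(pbox M') × Fin (d + 1) => ((a.1, Sum.inl a.2) : Idx M' (Fib d)))
      (fun t : Res (toSite r') Lc M' => (t.1 : ↥(pbox M'))))
    (hDb₁ : Db₁ = σ • Matrix.of fun (a : ↥(pbox M') × Fin (d + 1)) (t : Res (toSite r') Lc M') =>
      -(cbar * wbar a * tdelta M' ((a.1 : Site (d + 1)) + unitVec a.2) t.1))
    (hDb₂ : Db₂ = σ • Matrix.of fun (a : ↥(pbox M') × Fin (d + 1)) (t : Res (toSite r') Lc M') =>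
      (cbar * wbar a) ^ 2 * tdelta M' ((a.1 : Site (d + 1)) + unitVec a.2) t.1) :
    secondVar (τ₂ * Dbar) (τ₂ * Db₁) (τ₂ * Db₂) = 0 := by
  subst hτ₂ hDbar hDb₁ hDb₂
  have hLc : 0 < Lc := Nat.pos_of_ne_zero (NeZero.ne Lc)
  rw [Matrix.mul_smul, Matrix.mul_smul, Matrix.mul_smul, secondVar_smul hσ]
  -- the three products as `combRowsT · (jet on the full torus index) ↾ Subtype.val`
  have e1 : combF Lc M' r'
        * (Matrix.of fun (a : ↥(pbox M') × Fin (d + 1)) (t : Res (toSite r') Lc M') =>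
            -(cbar * wbar a * tdelta M' ((a.1 : Site (d + 1)) + unitVec a.2) t.1))
      = combRowsT (toSite r') Lc M'
          * (Matrix.of fun (q : Idx M' (Fib d)) (s : ↥(pbox M')) =>
              Sum.elim (fun a : Fin (d + 1) => -(cbar * wbar (q.1, a)) * tdelta M' ((q.1 : Site (d + 1)) + unitVec a) s) (fun _ => (0 : ℝ)) q.2).submatrix
            id Subtype.val := by
    rw [combF, ← submatrix_id_mul, ← submatrix_field_mul M' _ _ (fun y κ c => rfl)]
    congr 1
    ext b s
    simp only [Matrix.of_apply, Matrix.submatrix_apply, Sum.elim_inl]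
    ring
  have e2 : combF Lc M' r'
        * (Matrix.of fun (a : ↥(pbox M') × Fin (d + 1)) (t : Res (toSite r') Lc M') =>
            (cbar * wbar a) ^ 2 * tdelta M' ((a.1 : Site (d + 1)) + unitVec a.2) t.1)
      = combRowsT (toSite r') Lc M'
          * (Matrix.of fun (q : Idx M' (Fib d)) (s : ↥(pbox M')) =>
              Sum.elim (fun a : Fin (d + 1) => (cbar * wbar (q.1, a)) ^ 2 * tdelta M' ((q.1 : Site (d + 1)) + unitVec a) s) (fun _ => (0 : ℝ)) q.2).submatrix
            id Subtype.val := by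
    rw [combF, ← submatrix_id_mul, ← submatrix_field_mul M' _ _ (fun y κ c => rfl)]
    congr 1
  rw [e1, e2, combF]
  erw [submatrix_field_mul M' _ _ (TorusGaugeCovariance.tgrad_inr M'), submatrix_id_mul]
  exact secondVar_combRowsT_expJets_eq_zero hLc (toSite_mem_range hr') hM' cbar wbar

/-! ## §3 The comb rows read only the top-comb bonds: `uTop` from the square law ON THE COMB (containing #19's deadness and the exponential case) -/

/-- [folklore] **THE COARSE COMB ROWS READ NOTHING OFF THE COMB**: if two coarse matrices agree on every TOP-COMB bond row (`IsCombBondAt (toSite r′) Lc`),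
their products with `τ₂ = combF Lc M′ r′` agree — `torus_coarse_of_vanish_on_coarseComb` applied to the difference. -/
theorem combF_mul_congr_of_eqOn_comb (hr' : r' ∈ box (d + 1) Lc) (hM' : ∀ i, Lc ∣ M' i)
    {τ₂ : Matrix (Res (toSite r') Lc M') (↥(pbox M') × Fin (d + 1)) ℝ} (hτ₂ : τ₂ = combF Lc M' r')
    {σ' : Type*} (D E : Matrix (↥(pbox M') × Fin (d + 1)) σ' ℝ)
    (h : ∀ a : ↥(pbox M') × Fin (d + 1), IsCombBondAt (toSite r') Lc a.2 (a.1 : Site (d + 1)) → ∀ t, D a t = E a t) :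
    τ₂ * D = τ₂ * E := by
  rw [← sub_eq_zero, ← Matrix.mul_sub]
  exact torus_coarse_of_vanish_on_coarseComb M' (Nat.pos_of_ne_zero (NeZero.ne Lc)) hr' hM' (by rw [hτ₂]; rfl) (D - E)
    (fun a ha => funext fun t => by rw [Matrix.sub_apply, h a ha t, sub_self]; rfl)

/-- [folklore] **`uTop` FROM THE SQUARE LAW ON THE TOP COMB** (the clause that contains BOTH #19's `hDb₁ hDb₂` and the exponential jets): at `τ₂ = combF Lc M′ r′`
with `D̄ := σ • tgrad M′↾(fields × Res)`, `σ ≠ 0`, let `D̄₁ D̄₂` be ARBITRARY coarse matrices which, ON EVERY TOP-COMB BOND `a` (and only there), are tip-type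
with weights `u a`, `v a` — `D̄₁ a t = u a·[tip a = t]`, `D̄₂ a t = v a·[tip a = t]` — obeying the per-bond square law `σ·v a = (u a)²`.  Then
`secondVar (τ₂ * D̄) (τ₂ * D̄₁) (τ₂ * D̄₂) = 0`.  (Off the comb `D̄₁ D̄₂` are unconstrained: the comb rows do not read them.) -/
theorem torus_uTop_of_sq_on_comb (hr' : r' ∈ box (d + 1) Lc) (hM' : ∀ i, Lc ∣ M' i)
    {τ₂ : Matrix (Res (toSite r') Lc M') (↥(pbox M') × Fin (d + 1)) ℝ} (hτ₂ : τ₂ = combF Lc M' r') {σ : ℝ} (hσ : σ ≠ 0)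
    {Dbar : Matrix (↥(pbox M') × Fin (d + 1)) (Res (toSite r') Lc M') ℝ}
    (hDbar : Dbar = σ • (tgrad M').submatrix (fun a : ↥(pbox M') × Fin (d + 1) => ((a.1, Sum.inl a.2) : Idx M' (Fib d)))
      (fun t : Res (toSite r') Lc M' => (t.1 : ↥(pbox M'))))
    (Db₁ Db₂ : Matrix (↥(pbox M') × Fin (d + 1)) (Res (toSite r') Lc M') ℝ) (u v : ↥(pbox M') × Fin (d + 1) → ℝ)
    (hDb₁ : ∀ a : ↥(pbox M') × Fin (d + 1), IsCombBondAt (toSite r') Lc a.2 (a.1 : Site (d + 1)) →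
      ∀ t : Res (toSite r') Lc M', Db₁ a t = u a * tdelta M' ((a.1 : Site (d + 1)) + unitVec a.2) t.1)
    (hDb₂ : ∀ a : ↥(pbox M') × Fin (d + 1), IsCombBondAt (toSite r') Lc a.2 (a.1 : Site (d + 1)) →
      ∀ t : Res (toSite r') Lc M', Db₂ a t = v a * tdelta M' ((a.1 : Site (d + 1)) + unitVec a.2) t.1)
    (hsq : ∀ a : ↥(pbox M') × Fin (d + 1), IsCombBondAt (toSite r') Lc a.2 (a.1 : Site (d + 1)) → σ * v a = u a ^ 2) :
    secondVar (τ₂ * Dbar) (τ₂ * Db₁) (τ₂ * Db₂) = 0 := by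
  -- on the comb, `D̄₁ D̄₂` ARE the exponential jets along `c̄ := 1`, `w̄ a := −u a ∕ σ`
  rw [combF_mul_congr_of_eqOn_comb M' hr' hM' hτ₂ Db₁
      (σ • Matrix.of fun (a : ↥(pbox M') × Fin (d + 1)) (t : Res (toSite r') Lc M') =>
        -((1 : ℝ) * (-(u a) / σ) * tdelta M' ((a.1 : Site (d + 1)) + unitVec a.2) t.1))
      (fun a ha t => by rw [hDb₁ a ha t, Matrix.smul_apply, Matrix.of_apply, smul_eq_mul]; field_simp),
    combF_mul_congr_of_eqOn_comb M' hr' hM' hτ₂ Db₂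
      (σ • Matrix.of fun (a : ↥(pbox M') × Fin (d + 1)) (t : Res (toSite r') Lc M') =>
        ((1 : ℝ) * (-(u a) / σ)) ^ 2 * tdelta M' ((a.1 : Site (d + 1)) + unitVec a.2) t.1)
      (fun a ha t => by
        rw [hDb₂ a ha t, Matrix.smul_apply, Matrix.of_apply, smul_eq_mul]
        have h2 := hsq a ha
        field_simp
        linear_combination (tdelta M' ((a.1 : Site (d + 1)) + unitVec a.2) t.1) * h2)]
  exact torus_uTop_exp M' hr' hM' hτ₂ hσ 1 (fun a => -(u a) / σ) hDbar rfl rfl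

/-- [folklore] **`uTop` FOR JETS EXPONENTIAL ON THE TOP COMB** (Q-FP-20-1's «yes» branch, the comb-only form): `D̄₁ a t = σ·(−(c̄·w̄ a))·[tip a = t]`,
`D̄₂ a t = σ·(c̄·w̄ a)²·[tip a = t]` on every top-comb bond `a` (anything off the comb) ⇒ `secondVar (τ₂ * D̄) (τ₂ * D̄₁) (τ₂ * D̄₂) = 0`. -/
theorem torus_uTop_of_exp_on_comb (hr' : r' ∈ box (d + 1) Lc) (hM' : ∀ i, Lc ∣ M' i)
    {τ₂ : Matrix (Res (toSite r') Lc M') (↥(pbox M') × Fin (d + 1)) ℝ} (hτ₂ : τ₂ = combF Lc M' r') {σ : ℝ} (hσ : σ ≠ 0)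
    (cbar : ℝ) (wbar : ↥(pbox M') × Fin (d + 1) → ℝ)
    {Dbar : Matrix (↥(pbox M') × Fin (d + 1)) (Res (toSite r') Lc M') ℝ}
    (hDbar : Dbar = σ • (tgrad M').submatrix (fun a : ↥(pbox M') × Fin (d + 1) => ((a.1, Sum.inl a.2) : Idx M' (Fib d)))
      (fun t : Res (toSite r') Lc M' => (t.1 : ↥(pbox M'))))
    (Db₁ Db₂ : Matrix (↥(pbox M') × Fin (d + 1)) (Res (toSite r') Lc M') ℝ)
    (hDb₁ : ∀ a : ↥(pbox M') × Fin (d + 1), IsCombBondAt (toSite r') Lc a.2 (a.1 : Site (d + 1)) →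
      ∀ t : Res (toSite r') Lc M', Db₁ a t = σ * -(cbar * wbar a * tdelta M' ((a.1 : Site (d + 1)) + unitVec a.2) t.1))
    (hDb₂ : ∀ a : ↥(pbox M') × Fin (d + 1), IsCombBondAt (toSite r') Lc a.2 (a.1 : Site (d + 1)) →
      ∀ t : Res (toSite r') Lc M', Db₂ a t = σ * ((cbar * wbar a) ^ 2 * tdelta M' ((a.1 : Site (d + 1)) + unitVec a.2) t.1)) :
    secondVar (τ₂ * Dbar) (τ₂ * Db₁) (τ₂ * Db₂) = 0 := by
  rw [combF_mul_congr_of_eqOn_comb M' hr' hM' hτ₂ Db₁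
      (σ • Matrix.of fun (a : ↥(pbox M') × Fin (d + 1)) (t : Res (toSite r') Lc M') =>
        -(cbar * wbar a * tdelta M' ((a.1 : Site (d + 1)) + unitVec a.2) t.1))
      (fun a ha t => by rw [hDb₁ a ha t]; rfl),
    combF_mul_congr_of_eqOn_comb M' hr' hM' hτ₂ Db₂
      (σ • Matrix.of fun (a : ↥(pbox M') × Fin (d + 1)) (t : Res (toSite r') Lc M') =>
        (cbar * wbar a) ^ 2 * tdelta M' ((a.1 : Site (d + 1)) + unitVec a.2) t.1)
      (fun a ha t => by rw [hDb₂ a ha t]; rfl)]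
  exact torus_uTop_exp M' hr' hM' hτ₂ hσ cbar wbar hDbar rfl rfl

/-- [folklore] **#19's DEADNESS IS THE WEIGHT-ZERO CASE**: with `hDb₁ hDb₂` VERBATIM as displayed by `FP/NestedStepLawTorusCompositeOneShot` (the coarse jets'
rows VANISH on the top-comb bonds), `secondVar (τ₂ * D̄) (τ₂ * D̄₁) (τ₂ * D̄₂) = 0` — `torus_uTop_of_sq_on_comb` at `u = v = 0`. -/
theorem torus_uTop_of_dead (hr' : r' ∈ box (d + 1) Lc) (hM' : ∀ i, Lc ∣ M' i)
    {τ₂ : Matrix (Res (toSite r') Lc M') (↥(pbox M') × Fin (d + 1)) ℝ} (hτ₂ : τ₂ = combF Lc M' r') {σ : ℝ} (hσ : σ ≠ 0)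
    {Dbar : Matrix (↥(pbox M') × Fin (d + 1)) (Res (toSite r') Lc M') ℝ}
    (hDbar : Dbar = σ • (tgrad M').submatrix (fun a : ↥(pbox M') × Fin (d + 1) => ((a.1, Sum.inl a.2) : Idx M' (Fib d)))
      (fun t : Res (toSite r') Lc M' => (t.1 : ↥(pbox M'))))
    (Db₁ Db₂ : Matrix (↥(pbox M') × Fin (d + 1)) (Res (toSite r') Lc M') ℝ)
    (hDb₁ : ∀ a : ↥(pbox M') × Fin (d + 1), IsCombBondAt (toSite r') Lc a.2 (a.1 : Site (d + 1)) → Db₁ a = 0)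
    (hDb₂ : ∀ a : ↥(pbox M') × Fin (d + 1), IsCombBondAt (toSite r') Lc a.2 (a.1 : Site (d + 1)) → Db₂ a = 0) :
    secondVar (τ₂ * Dbar) (τ₂ * Db₁) (τ₂ * Db₂) = 0 :=
  torus_uTop_of_sq_on_comb M' hr' hM' hτ₂ hσ hDbar Db₁ Db₂ 0 0
    (fun a ha t => by rw [hDb₁ a ha]; simp only [Pi.zero_apply, zero_mul])
    (fun a ha t => by rw [hDb₂ a ha]; simp only [Pi.zero_apply, zero_mul])
    (fun a _ => by simp only [Pi.zero_apply, mul_zero, ne_eq, OfNat.ofNat_ne_zero, not_false_eq_true, zero_pow])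

omit [NeZero Lc] in
/-- [folklore] **BRIDGE TO THE DEPTH-1 CURRENCY**: the (B) ∕ (III′) calls display `D̄` as `of (s₁ · (s₂ · tgrad M′ (a.1, inl a.2) t.1))` (`s₁ = stepScale d Lc j`,
`s₂ = #B`); it IS the `σ • tgrad↾` shape of this file with `σ := s₁ · s₂` — rewrite `hDbar` with this lemma before calling §3 ∕ §4. -/
theorem of_mul_mul_tgrad_eq_smul (s₁ s₂ : ℝ) :
    (Matrix.of fun (a : ↥(pbox M') × Fin (d + 1)) (t : Res (toSite r') Lc M') => s₁ * (s₂ * tgrad M' (a.1, Sum.inl a.2) t.1))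
      = (s₁ * s₂) • (tgrad M').submatrix (fun a : ↥(pbox M') × Fin (d + 1) => ((a.1, Sum.inl a.2) : Idx M' (Fib d)))
          (fun t : Res (toSite r') Lc M' => (t.1 : ↥(pbox M'))) := by
  ext a t
  simp only [Matrix.of_apply, Matrix.smul_apply, Matrix.submatrix_apply, smul_eq_mul]
  ring

end Torus

/-! ## §4 The door's nested Faddeev–Popov letter `uT` with BOTH blocks automatic -/

section Door

variable (M' : Fin (d + 1) → ℕ) [∀ μ, NeZero (M' μ)] (Lc : ℕ) [NeZero Lc] {r' : Fin (d + 1) → ℕ}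

/-- [folklore] **THE DOOR's `uT` FROM THE SQUARE LAW ON THE TOP COMB** — `NestedFPSplit.secondVar_nestedFP_eq_zero_of_blocks` with `hup` automatic
(`det_combF_mul_smul_tgrad_res_ne_zero`) and `uTop := torus_uTop_of_sq_on_comb`; GENERIC in the fine data (`τ₁ Q₁₀ Q₁₁ Q₁₂ W₀ W₁ W₂` over any fine index
type `ν` and lower parameter type `ρ₁`), the covariance letters `c0 c1 c2`, the fine block's `hlow` ∕ `uLow` (AUTOMATIC at both calls: `torus_uLow_exp`,
`torus_uLow_oneShot_tower`) displayed; NO deadness and NO `t1 t2`. -/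
theorem torus_uT_of_sq_on_comb (hr' : r' ∈ box (d + 1) Lc) (hM' : ∀ i, Lc ∣ M' i)
    {τ₂ : Matrix (Res (toSite r') Lc M') (↥(pbox M') × Fin (d + 1)) ℝ} (hτ₂ : τ₂ = combF Lc M' r') {σ : ℝ} (hσ : σ ≠ 0)
    {Dbar : Matrix (↥(pbox M') × Fin (d + 1)) (Res (toSite r') Lc M') ℝ}
    (hDbar : Dbar = σ • (tgrad M').submatrix (fun a : ↥(pbox M') × Fin (d + 1) => ((a.1, Sum.inl a.2) : Idx M' (Fib d)))
      (fun t : Res (toSite r') Lc M' => (t.1 : ↥(pbox M'))))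
    {ν ρ₁ : Type*} [Fintype ν] [Fintype ρ₁] [DecidableEq ρ₁] (τ₁ : Matrix ρ₁ ν ℝ)
    (Q₁₀ Q₁₁ Q₁₂ : Matrix (↥(pbox M') × Fin (d + 1)) ν ℝ) (W₀ W₁ W₂ : Matrix ν (Res (toSite r') Lc M' ⊕ ρ₁) ℝ)
    (Db₁ Db₂ : Matrix (↥(pbox M') × Fin (d + 1)) (Res (toSite r') Lc M') ℝ) (u v : ↥(pbox M') × Fin (d + 1) → ℝ)
    (hDb₁ : ∀ a : ↥(pbox M') × Fin (d + 1), IsCombBondAt (toSite r') Lc a.2 (a.1 : Site (d + 1)) →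
      ∀ t : Res (toSite r') Lc M', Db₁ a t = u a * tdelta M' ((a.1 : Site (d + 1)) + unitVec a.2) t.1)
    (hDb₂ : ∀ a : ↥(pbox M') × Fin (d + 1), IsCombBondAt (toSite r') Lc a.2 (a.1 : Site (d + 1)) →
      ∀ t : Res (toSite r') Lc M', Db₂ a t = v a * tdelta M' ((a.1 : Site (d + 1)) + unitVec a.2) t.1)
    (hsq : ∀ a : ↥(pbox M') × Fin (d + 1), IsCombBondAt (toSite r') Lc a.2 (a.1 : Site (d + 1)) → σ * v a = u a ^ 2)
    (c0 : Q₁₀ * W₀ = Matrix.fromCols Dbar (0 : Matrix (↥(pbox M') × Fin (d + 1)) ρ₁ ℝ))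
    (c1 : Q₁₁ * W₀ + Q₁₀ * W₁ = Matrix.fromCols Db₁ (0 : Matrix (↥(pbox M') × Fin (d + 1)) ρ₁ ℝ))
    (c2 : Q₁₂ * W₀ + (2 : ℝ) • (Q₁₁ * W₁) + Q₁₀ * W₂ = Matrix.fromCols Db₂ (0 : Matrix (↥(pbox M') × Fin (d + 1)) ρ₁ ℝ))
    (hlow : (τ₁ * W₀.toCols₂).det ≠ 0) (uLow : secondVar (τ₁ * W₀.toCols₂) (τ₁ * W₁.toCols₂) (τ₁ * W₂.toCols₂) = 0) :
    secondVar (Matrix.fromRows (τ₂ * Q₁₀) τ₁ * W₀) (Matrix.fromRows (τ₂ * Q₁₁) (0 : Matrix ρ₁ ν ℝ) * W₀ + Matrix.fromRows (τ₂ * Q₁₀) τ₁ * W₁)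
        (Matrix.fromRows (τ₂ * Q₁₂) (0 : Matrix ρ₁ ν ℝ) * W₀ + Matrix.fromRows (τ₂ * Q₁₁) (0 : Matrix ρ₁ ν ℝ) * W₁
          + (Matrix.fromRows (τ₂ * Q₁₁) (0 : Matrix ρ₁ ν ℝ) * W₁ + Matrix.fromRows (τ₂ * Q₁₀) τ₁ * W₂)) = 0 :=
  secondVar_nestedFP_eq_zero_of_blocks τ₁ τ₂ Q₁₀ Q₁₁ Q₁₂ W₀ W₁ W₂ Dbar Db₁ Db₂ c0 c1 c2
    (by rw [hτ₂, hDbar]; exact det_combF_mul_smul_tgrad_res_ne_zero Lc M' hr' hM' hσ) hlow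
    (torus_uTop_of_sq_on_comb M' hr' hM' hτ₂ hσ hDbar Db₁ Db₂ u v hDb₁ hDb₂ hsq) uLow

/-- [folklore] **THE DOOR's `uT` AT #19's DEADNESS, PACKAGED** (= tree l.324–332 of `FP/NestedStepLawTorusCompositeOneShot` in one call, `t1 t2` not needed):
`hDb₁ hDb₂` VERBATIM ⇒ the nested Faddeev–Popov letter, given `c0 c1 c2 hlow uLow`. -/
theorem torus_uT_of_dead (hr' : r' ∈ box (d + 1) Lc) (hM' : ∀ i, Lc ∣ M' i)
    {τ₂ : Matrix (Res (toSite r') Lc M') (↥(pbox M') × Fin (d + 1)) ℝ} (hτ₂ : τ₂ = combF Lc M' r') {σ : ℝ} (hσ : σ ≠ 0)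
    {Dbar : Matrix (↥(pbox M') × Fin (d + 1)) (Res (toSite r') Lc M') ℝ}
    (hDbar : Dbar = σ • (tgrad M').submatrix (fun a : ↥(pbox M') × Fin (d + 1) => ((a.1, Sum.inl a.2) : Idx M' (Fib d)))
      (fun t : Res (toSite r') Lc M' => (t.1 : ↥(pbox M'))))
    {ν ρ₁ : Type*} [Fintype ν] [Fintype ρ₁] [DecidableEq ρ₁] (τ₁ : Matrix ρ₁ ν ℝ)
    (Q₁₀ Q₁₁ Q₁₂ : Matrix (↥(pbox M') × Fin (d + 1)) ν ℝ) (W₀ W₁ W₂ : Matrix ν (Res (toSite r') Lc M' ⊕ ρ₁) ℝ)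
    (Db₁ Db₂ : Matrix (↥(pbox M') × Fin (d + 1)) (Res (toSite r') Lc M') ℝ)
    (hDb₁ : ∀ a : ↥(pbox M') × Fin (d + 1), IsCombBondAt (toSite r') Lc a.2 (a.1 : Site (d + 1)) → Db₁ a = 0)
    (hDb₂ : ∀ a : ↥(pbox M') × Fin (d + 1), IsCombBondAt (toSite r') Lc a.2 (a.1 : Site (d + 1)) → Db₂ a = 0)
    (c0 : Q₁₀ * W₀ = Matrix.fromCols Dbar (0 : Matrix (↥(pbox M') × Fin (d + 1)) ρ₁ ℝ))
    (c1 : Q₁₁ * W₀ + Q₁₀ * W₁ = Matrix.fromCols Db₁ (0 : Matrix (↥(pbox M') × Fin (d + 1)) ρ₁ ℝ))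
    (c2 : Q₁₂ * W₀ + (2 : ℝ) • (Q₁₁ * W₁) + Q₁₀ * W₂ = Matrix.fromCols Db₂ (0 : Matrix (↥(pbox M') × Fin (d + 1)) ρ₁ ℝ))
    (hlow : (τ₁ * W₀.toCols₂).det ≠ 0) (uLow : secondVar (τ₁ * W₀.toCols₂) (τ₁ * W₁.toCols₂) (τ₁ * W₂.toCols₂) = 0) :
    secondVar (Matrix.fromRows (τ₂ * Q₁₀) τ₁ * W₀) (Matrix.fromRows (τ₂ * Q₁₁) (0 : Matrix ρ₁ ν ℝ) * W₀ + Matrix.fromRows (τ₂ * Q₁₀) τ₁ * W₁)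
        (Matrix.fromRows (τ₂ * Q₁₂) (0 : Matrix ρ₁ ν ℝ) * W₀ + Matrix.fromRows (τ₂ * Q₁₁) (0 : Matrix ρ₁ ν ℝ) * W₁
          + (Matrix.fromRows (τ₂ * Q₁₁) (0 : Matrix ρ₁ ν ℝ) * W₁ + Matrix.fromRows (τ₂ * Q₁₀) τ₁ * W₂)) = 0 :=
  secondVar_nestedFP_eq_zero_of_blocks τ₁ τ₂ Q₁₀ Q₁₁ Q₁₂ W₀ W₁ W₂ Dbar Db₁ Db₂ c0 c1 c2
    (by rw [hτ₂, hDbar]; exact det_combF_mul_smul_tgrad_res_ne_zero Lc M' hr' hM' hσ) hlow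
    (torus_uTop_of_dead M' hr' hM' hτ₂ hσ hDbar Db₁ Db₂ hDb₁ hDb₂) uLow

end Door

end Summit.QuantumFields.BalabanUV.Beta.FP.CoarseFPExponential

end
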